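import Mathlib.MeasureTheory.Integral.IntegralEqImproper
import Literature.NumberTheory.LFunctions.WeilOddThetaVector
import Literature.NumberTheory.LFunctions.DeBruijnPhiSecondDeriv
import Literature.NumberTheory.LFunctions.DeBruijnHZeroProofs
import Literature.NumberTheory.LFunctions.RiemannXiProofs
import HarnessLib

/-!
# The Mellin–Laplace transforms of Riemann's kernel and of its derivative: `Φ̂ = ξ`, `(Φ′)^ = −(s − ½)ξ`

Topic `Literature/NumberTheory/LFunctions`; companion of `WeilOddThetaVector.lean` (Riemann's kernel
`Φ = weilThetaPhi`, `Φ(t) = 2·deBruijnPhi(t/2)`, Titchmarsh (10.1.4), and its derivative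
`Φ′ = weilThetaPhiDeriv`, in the ADDITIVE variable of `WeilExplicit.lean`, where
`weilMellin g s = ĝ(s) = ∫_ℝ g(t) e^{(s − 1/2)t} dt`). We PROVE the two identities that the definition
file only records:

* `weilMellin_weilThetaPhi`: `Φ̂(s) = ξ(s) = riemannXi s` for EVERY complex `s` (Riemann's integral
  `ξ(1/2 + it) = ∫_ℝ Φ(u)e^{itu} du`, Titchmarsh (10.1.3), continued to the whole plane by the
  super-exponential decay of `Φ`; obtained from the tree's `deBruijnH_zero_eq_holds`,
  `H₀(z) = ξ(1/2 + iz/2)/8` for all `z ∈ ℂ`, by `z = −2i(s − 1/2)`, `cos(zu) = cosh((2s − 1)u)`, `u = t/2`);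
* `weilMellin_weilThetaPhiDeriv`: `(Φ′)^(s) = −(s − 1/2) ξ(s)` (one integration by parts on `ℝ`,
  Mathlib's `integral_mul_deriv_eq_deriv_mul_of_integrable`; the integrability of `Φ′(t)e^{(s−1/2)t}`
  comes from the explicit bound `|deBruijnPhiDeriv u| ≤ 5088 e^{u − (π/2)e^{4u}}` on `u ≥ 0`,
  `abs_deBruijnPhiDeriv_le`, proved here from the one-series form `deBruijnPhiDeriv_eq_tsum`);
* consequences: `(Φ′)^` vanishes at `s = 1/2` and at every zero of `ξ`, i.e. at every nontrivial zero
  of `ζ`, ON OR OFF the critical line (`weilMellin_weilThetaPhiDeriv_eq_zero_of_riemannZeta_eq_zero`),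
  and `Φ̂(0) = Φ̂(1) = 1/2` (`riemannXi_zero`).

This is the sense in which `Φ′` is a "global null vector" of Weil's form in the odd sector: by the
explicit formula `∑_ρ ĝ(ρ)(Φ′~)^(ρ) = W(g ⋆ (Φ′)~)` the right side vanishes — granted the explicit
formula for the non-compactly-supported (super-exponentially decaying, smooth) test `Φ′`, which the
tree's `explicit_formula_holds` (compact support) does not literally cover; that extension is NOT
claimed here. No named facts are introduced.

## References

* E. C. Titchmarsh, *The Theory of the Riemann Zeta-Function*, 2nd ed. (1986), §10.1
  eqs. (10.1.3)–(10.1.4). [Titchmarsh1986]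
* J. C. Lagarias, D. Montague, *The integral of the Riemann ξ-function* (2011), Lemma 3.1. [LagariasMontague2011]
* E. Bombieri, *Remarks on Weil's quadratic functional …* I, Rend. Lincei (9) 11 (2000), §2
  (the transform `f̃(s)`, here `weilMellin`). [Bombieri2000Weil]
-/

noncomputable section

open Complex Set MeasureTheory Filter
open scoped Real Topology

namespace Literature.NumberTheory.LFunctions

/-! ## 1. Weighted integrability of super-exponentially decaying functions -/

/-- The exponent estimate: for `b > 0` and real `c` there is `K` with `c·u − b·e^{2u} ≤ K − u` for all
`u ≥ 0` (`e^{2u} ≥ 1 + 2u + 2u²`). [folklore] -/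
theorem exists_linear_sub_mul_exp_le {b : ℝ} (hb : 0 < b) (c : ℝ) :
    ∃ K : ℝ, ∀ u : ℝ, 0 ≤ u → c * u - b * rexp (2 * u) ≤ K - u := by
  refine ⟨(c + 1) ^ 2 / (8 * b), fun u hu => ?_⟩
  have h4 : 1 + 2 * u + (2 * u) ^ 2 / 2 ≤ rexp (2 * u) := Real.quadratic_le_exp_of_nonneg (by linarith)
  have hsq : (c + 1) * u - 2 * b * u ^ 2 ≤ (c + 1) ^ 2 / (8 * b) := by
    rw [le_div_iff₀ (by positivity)]
    nlinarith [sq_nonneg (4 * b * u - (c + 1))]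
  nlinarith

/-- A continuous `f : ℝ → ℂ` which is integrable on `(0, ∞)` together with `t ↦ f(−t)` is integrable on
`ℝ`. [folklore] -/
theorem integrable_of_integrableOn_Ioi_comp_neg {f : ℝ → ℂ}
    (h1 : IntegrableOn f (Ioi 0)) (h2 : IntegrableOn (fun t => f (-t)) (Ioi 0)) : Integrable f := by
  have hIic : IntegrableOn f (Iic 0) := by
    rw [← Measure.map_neg_eq_self (volume : Measure ℝ)]
    let m : MeasurableEmbedding fun x : ℝ => -x := (Homeomorph.neg ℝ).measurableEmbedding
    rw [m.integrableOn_map_iff]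
    simp only [Function.comp_def, neg_preimage, neg_Iic, neg_zero]
    exact (integrableOn_Ici_iff_integrableOn_Ioi (b := (0:ℝ))).mpr h2
  have := hIic.union h1
  rwa [Iic_union_Ioi, integrableOn_univ] at this

/-- Weighted integrability on `(0, ∞)` from a super-exponential bound on `[0, ∞)`: if `f` is
continuous and `|f(t)| ≤ C exp(ct − b e^{2t})` for `t ≥ 0` (`b > 0`), then `f(t)e^{wt}` is integrable on
`(0, ∞)` for every complex `w`. [folklore] -/
theorem integrableOn_Ioi_mul_cexp_of_abs_le {f : ℝ → ℝ} (hf : Continuous f) {C c b : ℝ} (hb : 0 < b)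
    (hle : ∀ t : ℝ, 0 ≤ t → |f t| ≤ C * rexp (c * t - b * rexp (2 * t))) (w : ℂ) :
    IntegrableOn (fun t : ℝ => (f t : ℂ) * cexp (w * t)) (Ioi 0) := by
  obtain ⟨K, hK⟩ := exists_linear_sub_mul_exp_le hb (c + ‖w‖)
  have hcont : Continuous fun t : ℝ => (f t : ℂ) * cexp (w * t) := by fun_prop
  refine ((integrableOn_exp_neg_Ioi 0).const_mul (|C| * rexp K)).mono' hcont.aestronglyMeasurable
    (ae_restrict_of_forall_mem measurableSet_Ioi fun t (ht : 0 < t) => ?_)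
  have ht' : 0 ≤ t := ht.le
  rw [norm_mul, Complex.norm_real, Complex.norm_exp, Real.norm_eq_abs]
  have hre : (w * (t : ℂ)).re ≤ ‖w‖ * t := by
    rw [show (w * (t : ℂ)).re = w.re * t by simp]
    exact mul_le_mul_of_nonneg_right (Complex.re_le_norm w) ht'
  calc |f t| * rexp ((w * (t : ℂ)).re)
      ≤ (C * rexp (c * t - b * rexp (2 * t))) * rexp (‖w‖ * t) :=
        mul_le_mul (hle t ht') (Real.exp_le_exp.2 hre) (Real.exp_pos _).le
          ((abs_nonneg _).trans (hle t ht'))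
    _ = C * rexp ((c + ‖w‖) * t - b * rexp (2 * t)) := by
        rw [mul_assoc, ← Real.exp_add]; congr 2; ring
    _ ≤ |C| * rexp ((c + ‖w‖) * t - b * rexp (2 * t)) :=
        mul_le_mul_of_nonneg_right (le_abs_self C) (Real.exp_pos _).le
    _ ≤ |C| * (rexp K * rexp (-t)) := by
        gcongr
        rw [← Real.exp_add]
        exact Real.exp_le_exp.2 (by linarith [hK t ht'])
    _ = |C| * rexp K * rexp (-t) := by ring

/-- **Weighted integrability on `ℝ` from a two-sided super-exponential bound**: if `f` is continuous and
`|f(t)| ≤ C exp(c|t| − b e^{2|t|})` for all `t` (`b > 0`), then `t ↦ f(t) e^{wt}` is integrable on `ℝ` for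
every complex `w`. [folklore] -/
theorem integrable_mul_cexp_of_abs_le {f : ℝ → ℝ} (hf : Continuous f) {C c b : ℝ} (hb : 0 < b)
    (hle : ∀ t : ℝ, |f t| ≤ C * rexp (c * |t| - b * rexp (2 * |t|))) (w : ℂ) :
    Integrable fun t : ℝ => (f t : ℂ) * cexp (w * t) := by
  refine integrable_of_integrableOn_Ioi_comp_neg ?_ ?_
  · exact integrableOn_Ioi_mul_cexp_of_abs_le hf hb
      (fun t ht => by simpa [abs_of_nonneg ht] using hle t) w
  · have h := integrableOn_Ioi_mul_cexp_of_abs_le (f := fun t => f (-t)) (by fun_prop) hb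
      (fun t ht => by simpa [abs_of_nonneg ht, abs_neg] using hle (-t)) (-w)
    refine h.congr_fun (fun t _ => ?_) measurableSet_Ioi
    push_cast
    ring_nf

/-! ## 2. `Φ̂(s) = ξ(s)` for every complex `s` -/

/-- `Φ(t) e^{wt}` is integrable on `ℝ` for every complex `w` (super-exponential decay
`weilThetaPhi_le_exp`). [folklore] -/
theorem integrable_weilThetaPhi_mul_cexp (w : ℂ) :
    Integrable fun t : ℝ => (weilThetaPhi t : ℂ) * cexp (w * t) := by
  obtain ⟨C, hC⟩ := weilThetaPhi_le_exp
  refine integrable_mul_cexp_of_abs_le continuous_weilThetaPhi Real.pi_pos (C := C) (c := 9 / 2)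
    (fun t => ?_) w
  rw [abs_of_pos (weilThetaPhi_pos t)]
  exact hC t

/-- The integrand of `weilMellin Φ` is integrable: `Φ(t) e^{(s − 1/2)t} ∈ L¹(ℝ)`. [folklore] -/
theorem integrable_weilThetaPhi_weilIntegrand (s : ℂ) :
    Integrable fun t : ℝ => (weilThetaPhi t : ℂ) * cexp ((s - 1 / 2) * t) :=
  integrable_weilThetaPhi_mul_cexp _

/-- Folding `weilMellin` of the even kernel onto `(0, ∞)`:
`Φ̂(s) = ∫₀^∞ Φ(t) (e^{wt} + e^{−wt}) dt`, `w = s − 1/2`. [folklore] -/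
theorem weilMellin_weilThetaPhi_eq_integral_Ioi (s : ℂ) :
    weilMellin (fun t => (weilThetaPhi t : ℂ)) s =
      ∫ t in Ioi (0 : ℝ), (weilThetaPhi t : ℂ) * (cexp ((s - 1 / 2) * t) + cexp (-((s - 1 / 2) * t))) := by
  set w : ℂ := s - 1 / 2 with hw
  have hint := integrable_weilThetaPhi_mul_cexp w
  have hint' := integrable_weilThetaPhi_mul_cexp (-w)
  unfold weilMellin
  rw [← hw, ← intervalIntegral.integral_Iic_add_Ioi (b := (0 : ℝ)) hint.integrableOn hint.integrableOn]
  have h1 : ∫ t in Iic (0 : ℝ), (weilThetaPhi t : ℂ) * cexp (w * t) =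
      ∫ t in Ioi (0 : ℝ), (weilThetaPhi t : ℂ) * cexp (-(w * t)) := by
    have := integral_comp_neg_Ioi 0 (fun t : ℝ => (weilThetaPhi t : ℂ) * cexp (w * t))
    rw [neg_zero] at this
    rw [← this]
    refine setIntegral_congr_fun measurableSet_Ioi fun t _ => ?_
    simp only [weilThetaPhi_neg]
    push_cast
    ring_nf
  rw [h1, ← integral_add]
  · exact setIntegral_congr_fun measurableSet_Ioi fun t _ => by ring
  · refine hint'.integrableOn.congr_fun (fun t _ => ?_) measurableSet_Ioi
    ring_nf
  · exact hint.integrableOn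

/-- **Riemann's integral on the whole plane**: `Φ̂(s) = weilMellin Φ s = ξ(s)` for every complex `s`,
i.e. `∫_ℝ Φ(t) e^{(s − 1/2)t} dt = ξ(s)` for Riemann's kernel `Φ = weilThetaPhi` (Titchmarsh (10.1.3):
`Ξ(τ) = 2∫₀^∞ Φ(u) cos(τu) du`, the case `s = 1/2 + iτ`). From `deBruijnH_zero_eq_holds`
(`∫₀^∞ Φ_RT(u) cos(zu) du = ξ(1/2 + iz/2)/8`, all `z ∈ ℂ`) with `z = −2i(s − 1/2)` and `u = t/2`.
[cite: Titchmarsh1986, §10.1 eq. (10.1.3)] -/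
theorem weilMellin_weilThetaPhi (s : ℂ) : weilMellin (fun t => (weilThetaPhi t : ℂ)) s = riemannXi s := by
  set w : ℂ := s - 1 / 2 with hw
  -- the integrand on `(0, ∞)` after the change of variable
  set G : ℝ → ℂ := fun t => (weilThetaPhi t : ℂ) * (cexp (w * t) + cexp (-(w * t))) with hG
  -- Step 1: `ξ(s) = 8 H₀(z)`, `z = −2iw`
  have h1 : riemannXi s = 8 * deBruijnH 0 (-2 * I * w) := by
    have h := deBruijnH_zero_eq_holds (-2 * I * w)
    have hz : (1 : ℂ) / 2 + I * (-2 * I * w) / 2 = s := by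
      rw [hw]; ring_nf; rw [Complex.I_sq]; ring
    rw [hz] at h
    rw [h]; ring
  -- Step 2: `H₀(z) = ∫₀^∞ Φ_RT(u) cosh(2wu) du = ∫₀^∞ G(2u)/4 du`
  have h2 : deBruijnH 0 (-2 * I * w) = ∫ u in Ioi (0 : ℝ), (1 / 4 : ℂ) * G (2 * u) := by
    rw [deBruijnH]
    refine setIntegral_congr_fun measurableSet_Ioi fun u _ => ?_
    have hcos : Complex.cos (-2 * I * w * u) = (cexp (w * ((2 * u : ℝ) : ℂ)) +
        cexp (-(w * ((2 * u : ℝ) : ℂ)))) / 2 := by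
      rw [show -2 * I * w * (u : ℂ) = -(w * ((2 * u : ℝ) : ℂ)) * I by push_cast; ring, Complex.cos_mul_I,
        Complex.cosh_neg, Complex.cosh]
    have hΦ : (weilThetaPhi (2 * u) : ℂ) = 2 * deBruijnPhi u := by
      rw [weilThetaPhi, mul_div_cancel_left₀ u two_ne_zero]; push_cast; ring
    rw [hG]
    simp only [zero_mul, Real.exp_zero, hcos, hΦ]
    push_cast
    ring
  -- Step 3: `u = t/2`
  have h3 : ∫ u in Ioi (0 : ℝ), (1 / 4 : ℂ) * G (2 * u) = (1 / 8 : ℂ) * ∫ t in Ioi (0 : ℝ), G t := by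
    have key := integral_comp_mul_left_Ioi (fun t => (1 / 4 : ℂ) * G t) 0 two_pos
    rw [mul_zero] at key
    rw [key, integral_const_mul, Complex.real_smul]
    push_cast
    ring
  rw [weilMellin_weilThetaPhi_eq_integral_Ioi, h1, h2, h3, ← hw]
  ring

/-- `Φ̂(0) = 1/2`: `∫_ℝ Φ(t) e^{−t/2} dt = 1/2` (`ξ(0) = 1/2`). [folklore] -/
theorem weilMellin_weilThetaPhi_zero : weilMellin (fun t => (weilThetaPhi t : ℂ)) 0 = 1 / 2 := by
  rw [weilMellin_weilThetaPhi, riemannXi_zero]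

/-- `Φ̂(1) = 1/2`: `∫_ℝ Φ(t) e^{t/2} dt = 1/2` (`ξ(1) = 1/2`). [folklore] -/
theorem weilMellin_weilThetaPhi_one : weilMellin (fun t => (weilThetaPhi t : ℂ)) 1 = 1 / 2 := by
  rw [weilMellin_weilThetaPhi, riemannXi_one]


/-! ## 3. A super-exponential bound for `Φ′` -/

/-- `y³ e^{−y} ≤ 48 e^{−y/2}` for `y ≥ 0` (`(y/2)³/3! ≤ e^{y/2}`). [folklore] -/
theorem pow_three_mul_exp_neg_le_exp_neg_half {y : ℝ} (hy : 0 ≤ y) :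
    y ^ 3 * rexp (-y) ≤ 48 * rexp (-y / 2) := by
  have h := Real.pow_div_factorial_le_exp (y / 2) (by linarith) 3
  have h6 : (Nat.factorial 3 : ℝ) = 6 := by norm_num [Nat.factorial]
  rw [h6, div_le_iff₀ (by norm_num)] at h
  have h' : y ^ 3 ≤ 48 * rexp (y / 2) := by nlinarith
  calc y ^ 3 * rexp (-y) ≤ 48 * rexp (y / 2) * rexp (-y) := by gcongr
    _ = 48 * rexp (-y / 2) := by
        rw [mul_assoc, ← Real.exp_add]
        congr 2
        ring

/-- Termwise bound for the series of `Φ′` (`deBruijnPhiDeriv_eq_tsum`): for `x ≥ 1`, with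
`ρ = e^{−πx/2}`, `|y_n(8y_n² − 30y_n + 15)e^{−y_n}| ≤ 53 y_n³ e^{−y_n} ≤ 2544 e^{−y_n/2} ≤ 2544 ρ^{n+1}`.
[folklore] -/
theorem abs_phiPolyTerm_deriv_le {x : ℝ} (hx : 1 ≤ x) (n : ℕ) :
    |phiPolyTerm 15 (-30) 8 0 x n| ≤ 2544 * (rexp (-(π * x / 2)) * rexp (-(π * x / 2)) ^ n) := by
  have hπ := Real.pi_gt_three
  set y := thetaFreq x n with hydef
  have hyx : π * x ≤ y := pi_mul_le_thetaFreq (zero_le_one.trans hx) n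
  have hy1 : 1 ≤ y := by nlinarith
  have hy0 : 0 ≤ y := zero_le_one.trans hy1
  -- the polynomial factor
  have hpoly : |15 * y + -30 * y ^ 2 + 8 * y ^ 3 + 0 * y ^ 4| ≤ 53 * y ^ 3 := by
    have h1 : y ≤ y ^ 3 := by
      nlinarith [mul_nonneg (mul_nonneg hy0 (sub_nonneg.2 hy1)) (by linarith : (0 : ℝ) ≤ y + 1)]
    have h2 : y ^ 2 ≤ y ^ 3 := by nlinarith [mul_nonneg (sq_nonneg y) (sub_nonneg.2 hy1)]
    rw [abs_le]
    constructor <;> nlinarith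
  -- the geometric factor: `e^{−y/2} ≤ ρ^{n+1}` since `y ≥ πx(n+1)`
  have hgeom : rexp (-y / 2) ≤ rexp (-(π * x / 2)) * rexp (-(π * x / 2)) ^ n := by
    rw [← pow_succ', ← Real.exp_nat_mul]
    apply Real.exp_le_exp.2
    have hn : (0 : ℝ) ≤ n := n.cast_nonneg
    have h : π * x * ((n : ℝ) + 1) ≤ y := by
      rw [hydef, thetaFreq]
      have : (n : ℝ) + 1 ≤ ((n : ℝ) + 1) ^ 2 := by nlinarith
      nlinarith [Real.pi_pos, mul_nonneg Real.pi_pos.le (zero_le_one.trans hx)]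
    push_cast
    linarith
  calc |phiPolyTerm 15 (-30) 8 0 x n|
      = |15 * y + -30 * y ^ 2 + 8 * y ^ 3 + 0 * y ^ 4| * rexp (-y) := by
        rw [phiPolyTerm, abs_mul, abs_of_pos (Real.exp_pos _)]
    _ ≤ 53 * y ^ 3 * rexp (-y) := by gcongr
    _ = 53 * (y ^ 3 * rexp (-y)) := by ring
    _ ≤ 53 * (48 * rexp (-y / 2)) :=
        mul_le_mul_of_nonneg_left (pow_three_mul_exp_neg_le_exp_neg_half hy0) (by norm_num)
    _ = 2544 * rexp (-y / 2) := by ring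
    _ ≤ 2544 * (rexp (-(π * x / 2)) * rexp (-(π * x / 2)) ^ n) := by gcongr

/-- **Super-exponential decay of `Φ_RT′`**: `|deBruijnPhiDeriv u| ≤ 5088 exp(u − (π/2) e^{4u})` for
`u ≥ 0` (from the one-series form and `∑_n ρ^{n+1} ≤ 2ρ`, `ρ = e^{−πx/2} ≤ 1/2`). [folklore] -/
theorem abs_deBruijnPhiDeriv_le {u : ℝ} (hu : 0 ≤ u) :
    |deBruijnPhiDeriv u| ≤ 5088 * rexp (u - π / 2 * rexp (4 * u)) := by
  have hπ := Real.pi_gt_three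
  have hx1 : 1 ≤ rexp (4 * u) := Real.one_le_exp (by linarith)
  set x := rexp (4 * u) with hxdef
  set ρ := rexp (-(π * x / 2)) with hρ
  have hρ0 : 0 ≤ ρ := (Real.exp_pos _).le
  have hρhalf : ρ ≤ 1 / 2 := by
    have h2 : 2 ≤ rexp (π * x / 2) := by
      have := Real.add_one_le_exp (π * x / 2)
      nlinarith
    have hpos := Real.exp_pos (π * x / 2)
    rw [hρ, Real.exp_neg, inv_eq_one_div, div_le_div_iff₀ hpos two_pos]
    linarith
  have hρ1 : ρ < 1 := by linarith
  have hsum : HasSum (fun n : ℕ => 2544 * (ρ * ρ ^ n)) (2544 * (ρ * (1 - ρ)⁻¹)) :=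
    ((hasSum_geometric_of_lt_one hρ0 hρ1).mul_left ρ).mul_left 2544
  have hbound : ‖∑' n, phiPolyTerm 15 (-30) 8 0 x n‖ ≤ 2544 * (ρ * (1 - ρ)⁻¹) :=
    tsum_of_norm_bounded hsum fun n => by
      rw [Real.norm_eq_abs]; exact abs_phiPolyTerm_deriv_le hx1 n
  have hgeo : ρ * (1 - ρ)⁻¹ ≤ 2 * ρ := by
    rw [← div_eq_mul_inv, div_le_iff₀ (by linarith)]
    nlinarith
  rw [Real.norm_eq_abs] at hbound
  rw [deBruijnPhiDeriv_eq_tsum, abs_neg, abs_mul, abs_of_pos (Real.exp_pos u), ← hxdef]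
  calc rexp u * |∑' n, phiPolyTerm 15 (-30) 8 0 x n| ≤ rexp u * (2544 * (2 * ρ)) := by
        refine mul_le_mul_of_nonneg_left (hbound.trans ?_) (Real.exp_pos u).le
        exact mul_le_mul_of_nonneg_left hgeo (by norm_num)
    _ = 5088 * (rexp u * ρ) := by ring
    _ = 5088 * rexp (u - π / 2 * x) := by
        rw [hρ, ← Real.exp_add]
        congr 2
        ring

/-- **Super-exponential decay of `Φ′ = weilThetaPhiDeriv`** (two-sided, by oddness):
`|Φ′(t)| ≤ 5088 exp(|t|/2 − (π/2)e^{2|t|})`. [folklore] -/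
theorem abs_weilThetaPhiDeriv_le (t : ℝ) :
    |weilThetaPhiDeriv t| ≤ 5088 * rexp (1 / 2 * |t| - π / 2 * rexp (2 * |t|)) := by
  have key : ∀ s : ℝ, 0 ≤ s → |weilThetaPhiDeriv s| ≤ 5088 * rexp (1 / 2 * s - π / 2 * rexp (2 * s)) := by
    intro s hs
    have h := abs_deBruijnPhiDeriv_le (u := s / 2) (by linarith)
    have e1 : (4 : ℝ) * (s / 2) = 2 * s := by ring
    have e2 : s / 2 - π / 2 * rexp (2 * s) = 1 / 2 * s - π / 2 * rexp (2 * s) := by ring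
    rw [e1, e2] at h
    exact h
  rcases le_or_gt 0 t with ht | ht
  · simpa [abs_of_nonneg ht] using key t ht
  · have := key (-t) (by linarith)
    rw [weilThetaPhiDeriv_neg, abs_neg] at this
    simpa [abs_of_neg ht] using this

/-- `Φ′(t) e^{wt}` is integrable on `ℝ` for every complex `w`. [folklore] -/
theorem integrable_weilThetaPhiDeriv_mul_cexp (w : ℂ) :
    Integrable fun t : ℝ => (weilThetaPhiDeriv t : ℂ) * cexp (w * t) :=
  integrable_mul_cexp_of_abs_le continuous_weilThetaPhiDeriv (by positivity : (0 : ℝ) < π / 2)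
    abs_weilThetaPhiDeriv_le w

/-! ## 4. `(Φ′)^(s) = −(s − 1/2) ξ(s)` and its zeros -/

/-- **The transform of `Φ′`**: `weilMellin Φ′ s = −(s − 1/2) ξ(s)` for every complex `s` (integration by
parts on `ℝ`; the boundary terms vanish by the decay of `Φ` and `Φ′`). This is Lemma 2.1 of the 2001
programme's `odd-sector-eigenfunction-sign` notes, here a theorem. [folklore] -/
theorem weilMellin_weilThetaPhiDeriv (s : ℂ) :
    weilMellin (fun t => (weilThetaPhiDeriv t : ℂ)) s = -(s - 1 / 2) * riemannXi s := by
  rw [← weilMellin_weilThetaPhi]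
  unfold weilMellin
  set w : ℂ := s - 1 / 2 with hw
  have hu : ∀ t : ℝ, HasDerivAt (fun t : ℝ => cexp (w * t)) (w * cexp (w * t)) t := by
    intro t
    have h1 : HasDerivAt (fun t : ℝ => w * (t : ℂ)) (w * 1) t :=
      (Complex.ofRealCLM.hasDerivAt.const_mul w).congr_deriv (by simp)
    have h2 := (Complex.hasDerivAt_exp (w * t)).comp t h1
    simpa [mul_comm, Function.comp_def] using h2
  have hv : ∀ t : ℝ, HasDerivAt (fun t : ℝ => (weilThetaPhi t : ℂ)) (weilThetaPhiDeriv t) t := fun t =>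
    (hasDerivAt_weilThetaPhi t).ofReal_comp
  have key := integral_mul_deriv_eq_deriv_mul_of_integrable (u := fun t : ℝ => cexp (w * t))
    (u' := fun t : ℝ => w * cexp (w * t)) (v := fun t : ℝ => (weilThetaPhi t : ℂ))
    (v' := fun t : ℝ => (weilThetaPhiDeriv t : ℂ)) (fun t _ => hu t) (fun t _ => hv t) ?_ ?_ ?_
  · calc ∫ t : ℝ, (weilThetaPhiDeriv t : ℂ) * cexp (w * t)
        = ∫ t : ℝ, cexp (w * t) * weilThetaPhiDeriv t := by congr 1 with t; ring
      _ = -∫ t : ℝ, w * cexp (w * t) * weilThetaPhi t := key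
      _ = -w * ∫ t : ℝ, (weilThetaPhi t : ℂ) * cexp (w * t) := by
          rw [neg_mul, ← integral_const_mul]
          congr 2 with t
          ring
  · exact (integrable_weilThetaPhiDeriv_mul_cexp w).congr (Eventually.of_forall fun t => by
      simp [mul_comm])
  · exact ((integrable_weilThetaPhi_mul_cexp w).const_mul w).congr (Eventually.of_forall fun t => by
      simp [Pi.mul_apply]; ring)
  · exact (integrable_weilThetaPhi_mul_cexp w).congr (Eventually.of_forall fun t => by simp [mul_comm])

/-- `(Φ′)^(1/2) = 0` (`Φ′` is odd; also the factor `s − 1/2`). [folklore] -/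
theorem weilMellin_weilThetaPhiDeriv_half : weilMellin (fun t => (weilThetaPhiDeriv t : ℂ)) (1 / 2) = 0 := by
  rw [weilMellin_weilThetaPhiDeriv, sub_self, neg_zero, zero_mul]

/-- `(Φ′)^(ρ) = 0` at every zero `ρ` of `ξ`. [folklore] -/
theorem weilMellin_weilThetaPhiDeriv_eq_zero_of_riemannXi_eq_zero {ρ : ℂ} (h : riemannXi ρ = 0) :
    weilMellin (fun t => (weilThetaPhiDeriv t : ℂ)) ρ = 0 := by
  rw [weilMellin_weilThetaPhiDeriv, h, mul_zero]

/-- **`Φ′` is annihilated at every nontrivial zero of `ζ`, on or off the critical line**: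
if `ζ(ρ) = 0` with `0 < Re ρ < 1` then `(Φ′)^(ρ) = 0` (`riemannXi_eq_zero_iff_holds`). [folklore] -/
theorem weilMellin_weilThetaPhiDeriv_eq_zero_of_riemannZeta_eq_zero {ρ : ℂ} (hζ : riemannZeta ρ = 0)
    (h0 : 0 < ρ.re) (h1 : ρ.re < 1) : weilMellin (fun t => (weilThetaPhiDeriv t : ℂ)) ρ = 0 :=
  weilMellin_weilThetaPhiDeriv_eq_zero_of_riemannXi_eq_zero ((riemannXi_eq_zero_iff_holds ρ).2 ⟨hζ, h0, h1⟩)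

/-- The transform of `Φ′` also vanishes at `1 − ρ` and `conj ρ`-symmetric points automatically; recorded
form: `(Φ′)^(1 − s) = (s − 1/2) ξ(s) = −(Φ′)^(s)` (functional equation `ξ(1 − s) = ξ(s)`). [folklore] -/
theorem weilMellin_weilThetaPhiDeriv_one_sub (s : ℂ) :
    weilMellin (fun t => (weilThetaPhiDeriv t : ℂ)) (1 - s) =
      -weilMellin (fun t => (weilThetaPhiDeriv t : ℂ)) s := by
  rw [weilMellin_weilThetaPhiDeriv, weilMellin_weilThetaPhiDeriv, riemannXi_one_sub]
  ring


end Literature.NumberTheory.LFunctions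

end
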